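import Mathlib
import HarnessLib
import Literature.LinearAlgebra.Matrix.ChordalPositiveSemidefiniteCompletion

/-!
# Maximum-determinant positive definite completion and covariance selection
(Grone–Johnson–Sá–Wolkowicz 1984, Thm 2; Fukuda–Kojima–Murota–Nakata 2001, §2.3;
Vandenberghe–Andersen 2015, §10.2; Vandenberghe–Boyd–Wu 1998, §2.2 and §3)

Third file of the chordal-sparsity series (`ChordalPositiveSemidefinite`: the clique
decomposition [VA15, Thm 9.2]; `ChordalPositiveSemidefiniteCompletion`: PSD completability
[VA15, Thm 10.1]).  This file records the MAXIMUM-DETERMINANT COMPLETION — the completion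
`Ŵ ≻ 0` of a partial matrix that maximises `det` (equivalently `log det`, the "maximum entropy
completion", [VA15, (10.3)]; Dempster's covariance selection), characterised by the optimality
conditions `Π_E(Ŵ) = A`, `Ŵ ≻ 0`, `Ŵ⁻¹ ∈ 𝐒ⁿ_E` [VA15, (10.5)]: THE INVERSE OF THE MAXIMUM-DETERMINANT
COMPLETION HAS THE SPARSITY PATTERN.  This is the matrix-completion half of the conversion /
completion framework for sparse semidefinite programming of [FKMN01] (their Thm 2.4, Lemma 2.6,
the sparse factorization formula (2.10) and Lemma 2.7).

For an ARBITRARY symmetric pattern `E` (entries prescribed on the diagonal and on `E`):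

* `det_le_det_of_re_trace_inv_mul_le` — the determinant inequality behind everything: `W ≻ 0`,
  `W' ⪰ 0`, `Re tr(W⁻¹ W') ≤ n ⟹ det W' ≤ det W`, with equality only at `W' = W` (strict
  log-concavity of `det`, [GJSW84, §3]).
* `det_le_det_of_inv_hasPattern` — [GJSW84, Thm 2] / [FKMN01, Thm 2.4], the characterisation: a
  positive definite completion `W` with `W⁻¹ ∈ 𝐒ⁿ_E` has `det W' ≤ det W` for EVERY positive
  semidefinite completion `W'` of the same data, with equality only for `W' = W`
  (`tr(W⁻¹ W') = tr(W⁻¹ W) = n` because `W⁻¹` only sees prescribed entries,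
  `trace_mul_eq_of_hasPattern_of_agree`).
* `eq_of_posDef_of_inv_hasPattern` — hence at most one positive definite completion has its
  inverse in the pattern.
* `log_det_sub_log_det_le` — concavity of `log det` on `𝐒ⁿ₊₊` in gradient form,
  `log det W' - log det W ≤ Re tr(W⁻¹ W') - n` for `W, W' ≻ 0` with equality only at `W' = W`
  (nonnegativity of the max-det duality gap `Tr(G(x)W) - log det(G(x)W) - l ≥ 0`, zero only if
  `G(x)W = I`, [VBW98, §3, (3.2)]).
* `eq_of_posDef_of_inv_agree_off_pattern` — [VBW98, §2.2, (2.2)–(2.3)]: a positive definite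
  completion is determined by the FREE entries of its inverse (two positive definite completions
  of the same data whose inverses agree off the pattern coincide; summing the two gradient
  inequalities gives `2n = 2n`, so both are equalities).
* `covarianceSelection_optimal` — the dual problem [VA15, (10.4)]
  `minimize tr(A Y) - log det Y` over `Y ∈ 𝐒ⁿ₊₊ ∩ 𝐒ⁿ_E` (Dempster's covariance selection /
  Gaussian maximum likelihood with prescribed zeros in the precision matrix): if `W ≻ 0` agrees
  with `A` on the prescribed entries and `W⁻¹ ∈ 𝐒ⁿ_E`, then `Y = W⁻¹` is the unique minimiser and
  the optimal value is `n + log det W` (the optimality conditions (10.5) read from the dual side).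

For a CHORDAL pattern (symmetric `E` monotone transitive for the order of the index type, i.e. the
order is a perfect elimination ordering, [VA15, Thm 4.1]):

* `exists_completion_and_inverse_of_subset` / `inverse_border_step` / `border_mulVec_single_sub`
  — the constructive existence proof [VA15, §10.2, (10.6)–(10.7), Algorithm 10.1] (= the recursive
  application of [FKMN01, Lemma 2.6] along the elimination ordering, formula (2.10)): eliminating
  the lowest vertex `a` of `S`, complete on `S ∖ {a}` to `P` with `K P = 1_{S∖{a}}`, `K ∈ 𝐒ⁿ_E`,
  border `P` by the column `u = P c` (`c` supported on `adj⁺(a) ∩ S` solving the clique-block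
  range equation, as in the PSD completion) and the TRUE diagonal entry `X_aa`, and add one column
  `ℓ = e_a - c` of the inverse factor: `K' = K + σ⁻¹ ℓ ℓ⋆`, `σ = X_aa - c⋆ P c > 0`; the column
  equation `W ℓ = σ e_a` ((10.6)) gives `K' W = 1_S`, and `ℓ ℓ⋆` lives on the complete block
  `col(a) × col(a)`, so `K'` keeps the pattern.
* `exists_posDef_completion_inv_hasPattern`, **`exists_unique_maxDet_completion`** — if every
  clique block `X[col(v), col(v)]` is positive definite there is a unique maximum-determinant
  positive semidefinite completion; it is positive definite and it is the completion whose inverse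
  has pattern `E` ([FKMN01, Thm 2.4 + Lemma 2.7]; [VA15, §10.2]).
* `posDef_completable_iff` (`simpleGraph_posDef_completable_iff`) — [FKMN01, Thm 2.5(ii)], the
  interior half `Π_E(𝐒ⁿ₊₊) = {A | all A_ββ ≻ 0}` of [VA15, Thm 10.1]: a positive DEFINITE
  completion exists iff every clique block is positive definite.
* `exists_covarianceSelection` — [VA15, §10.2]: for `A ∈ Π_E(𝐒ⁿ₊₊)` (all clique blocks positive
  definite) the dual (10.4) has a unique solution `Y ≻ 0` WITH PATTERN `E`, and `Y⁻¹` is a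
  (the maximum-determinant) completion of `A`.

Scalars: an `RCLike` field `𝕜` (`ℝ` or `ℂ`); `Matrix.PosDef` / `Matrix.PosSemidef` with
`open scoped ComplexOrder`; "agrees on the prescribed entries" is
`∀ i j, (i = j ∨ E i j) → W i j = X i j`, "inverse in the pattern" is `HasPattern E W⁻¹`
(`ChordalSparsity.HasPattern`: off-diagonal entries outside `E` vanish).

NOT in this file: existence of the maximiser for NON-chordal patterns ([GJSW84, Thm 2] in full:
compactness of the set of completions plus the first-order condition (3.3)) and, dually, existence
of a minimiser of (10.4) without chordality, strong duality (10.3) = (10.4) as a theorem about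
optimal VALUES of two problems over possibly empty feasible sets ([VBW98, Thm 3.1]), the
statistical reading of (10.4), the determinant formula `det Ŵ = Π_j det D_νν⁻¹` /
[FKMN01, (2.14)], the semidefinite (boundary) variant
[VA15, (10.9)–(10.12)] with pseudo-inverses (its completion half is
`ChordalPositiveSemidefiniteCompletion`), clique-tree / supernodal bookkeeping, and the
real AM–GM determinant bounds of `Literature.LinearAlgebra.Matrix.DetTraceAMGM`.

References (keys of `lean/references.bib`): [GroneEtAl1984] R. Grone, C. R. Johnson, E. M. Sá,
H. Wolkowicz, *Positive definite completions of partial Hermitian matrices*, Linear Algebra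
Appl. 58 (1984) 109–124, doi:10.1016/0024-3795(84)90207-6 — §3 (3.1)–(3.3) and §4 Thm 2
(pp. 113–115; page checks against `lit` key `paper:doi-10-1016-0024-3795-84-90207-6`);
[FukudaEtAl2001] M. Fukuda, M. Kojima, K. Murota, K. Nakata, *Exploiting sparsity in semidefinite
programming via matrix completion I: general framework*, SIAM J. Optim. 11 (2001) 647–674,
doi:10.1137/S1052623400366218 — §2.3 Thm 2.4, Thm 2.5, Lemma 2.6, (2.10)–(2.15), Lemma 2.7
(pp. 655–658; `lit` key `paper:doi-10-1137-s1052623400366218`); [VandenbergheAndersen2015]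
L. Vandenberghe, M. S. Andersen, *Chordal graphs and semidefinite optimization*, Found. Trends
Optim. 1 (2015) 241–433, doi:10.1561/2400000006 — §10.2 (10.3)–(10.7) and Algorithm 10.1
(pp. 358–360; authors' copy, `lit` key `paper:url-1b9fdea6a8a3`); [VandenbergheBoydWu1998]
L. Vandenberghe, S. Boyd, S.-P. Wu, *Determinant maximization with linear matrix inequality
constraints*, SIAM J. Matrix Anal. Appl. 19 (1998) 499–533, doi:10.1137/S0895479896303430 —
§2.2 "Matrix completion problems" (maximum entropy completion; (2.2)–(2.3) parametrization of all
positive definite completions) and §3 Thm 3.1 with the duality gap (3.2) (authors' copy pp. 5 and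
15–16, `lit` key `paper:doi-10-1137-s0895479896303430`).  Dempster's "covariance selection"
(Biometrics 28 (1972) 157–175) is reference [68] of [VA15] and [27] of [VBW98].
-/

noncomputable section

open scoped ComplexOrder MatrixOrder
open Matrix Finset

namespace Literature.LinearAlgebra.Matrix

namespace ChordalSparsity

variable {𝕜 : Type*} [RCLike 𝕜]
variable {ι : Type*}

/-! ### The scalar inequality `Π μᵢ ≤ 1` when `Σ μᵢ ≤ n` -/

section Scalar

/-- For nonnegative reals `μ i` (`i ∈ s`) with `Σ μ i ≤ #s` one has `Π μ i ≤ 1`, with equality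
only if every `μ i = 1` (the information inequality `log x ≤ x - 1`, strict off `x = 1`).
[folklore] -/
private theorem prod_le_one_of_sum_le_card {α : Type*} (s : Finset α) (μ : α → ℝ)
    (h0 : ∀ i ∈ s, 0 ≤ μ i) (hs : ∑ i ∈ s, μ i ≤ s.card) :
    ∏ i ∈ s, μ i ≤ 1 ∧ (∏ i ∈ s, μ i = 1 → ∀ i ∈ s, μ i = 1) := by
  by_cases hz : ∃ i ∈ s, μ i = 0
  · obtain ⟨i, hi, hμi⟩ := hz
    rw [Finset.prod_eq_zero hi hμi]
    exact ⟨zero_le_one, fun h => absurd h zero_ne_one⟩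
  push Not at hz
  have hpos : ∀ i ∈ s, 0 < μ i := fun i hi => lt_of_le_of_ne (h0 i hi) (hz i hi).symm
  have hprodpos : 0 < ∏ i ∈ s, μ i := Finset.prod_pos hpos
  -- `Σ log μ ≤ Σ (μ - 1) ≤ 0`
  have hlog : Real.log (∏ i ∈ s, μ i) = ∑ i ∈ s, Real.log (μ i) := Real.log_prod hz
  have hsum1 : ∑ i ∈ s, (μ i - 1) ≤ 0 := by
    rw [Finset.sum_sub_distrib, Finset.sum_const, nsmul_eq_mul, mul_one]
    linarith
  have hterm : ∀ i ∈ s, Real.log (μ i) ≤ μ i - 1 := fun i hi => Real.log_le_sub_one_of_pos (hpos i hi)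
  have hlogle : ∑ i ∈ s, Real.log (μ i) ≤ ∑ i ∈ s, (μ i - 1) := Finset.sum_le_sum hterm
  refine ⟨?_, fun h1 => ?_⟩
  · rw [← Real.log_nonpos_iff hprodpos.le, hlog]
    linarith
  · have hlog0 : ∑ i ∈ s, Real.log (μ i) = 0 := by rw [← hlog, h1, Real.log_one]
    -- the slack `μ i - 1 - log μ i ≥ 0` sums to `≤ 0`, hence vanishes termwise
    have hslack : ∑ i ∈ s, (μ i - 1 - Real.log (μ i)) = 0 := by
      apply le_antisymm
      · rw [Finset.sum_sub_distrib, hlog0, sub_zero]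
        exact hsum1
      · exact Finset.sum_nonneg fun i hi => sub_nonneg.mpr (hterm i hi)
    intro i hi
    have hi0 : μ i - 1 - Real.log (μ i) = 0 :=
      (Finset.sum_eq_zero_iff_of_nonneg fun j hj => sub_nonneg.mpr (hterm j hj)).mp hslack i hi
    by_contra hne
    have := Real.log_lt_sub_one_of_pos (hpos i hi) hne
    linarith

/-- For positive reals, `Σ log μ i ≤ Σ (μ i - 1)`, with equality only if every `μ i = 1`
(`log x ≤ x - 1`, strict off `x = 1`). [folklore] -/
private theorem sum_log_le_sum_sub_one {α : Type*} (s : Finset α) (μ : α → ℝ)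
    (hpos : ∀ i ∈ s, 0 < μ i) :
    ∑ i ∈ s, Real.log (μ i) ≤ ∑ i ∈ s, (μ i - 1) ∧
      (∑ i ∈ s, Real.log (μ i) = ∑ i ∈ s, (μ i - 1) → ∀ i ∈ s, μ i = 1) := by
  have hterm : ∀ i ∈ s, Real.log (μ i) ≤ μ i - 1 := fun i hi =>
    Real.log_le_sub_one_of_pos (hpos i hi)
  refine ⟨Finset.sum_le_sum hterm, fun heq i hi => ?_⟩
  by_contra hne
  have hlt : Real.log (μ i) < μ i - 1 := Real.log_lt_sub_one_of_pos (hpos i hi) hne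
  have : ∑ j ∈ s, Real.log (μ j) < ∑ j ∈ s, (μ j - 1) := Finset.sum_lt_sum hterm ⟨i, hi, hlt⟩
  exact absurd heq this.ne

end Scalar

/-! ### Determinant comparison: the unique maximiser of `det` under a trace budget -/

section Determinant

variable [Fintype ι] [DecidableEq ι]

/-- Congruence normal form of a pair `W ≻ 0`, `W' ⪰ 0`: `W = Aᴴ A` with `A` invertible and
`W' = Aᴴ M A` with `M = A⁻ᴴ W' A⁻¹ ⪰ 0`, so that `det W' = det M · det W` and `tr M = tr(W⁻¹ W')`.
[folklore] -/
private theorem congruence_normal_form {W W' : Matrix ι ι 𝕜} (hW : W.PosDef)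
    (hW' : W'.PosSemidef) :
    ∃ A M : Matrix ι ι 𝕜, M.PosSemidef ∧ W = Aᴴ * A ∧ W' = Aᴴ * M * A ∧
      W'.det = M.det * W.det ∧ M.trace = (W⁻¹ * W').trace := by
  -- factor `W = Aᴴ A` with `A` invertible, `B = A⁻¹`
  obtain ⟨A, hA⟩ := CStarAlgebra.nonneg_iff_eq_star_mul_self.mp hW.posSemidef.nonneg
  have hWA : W = Aᴴ * A := by rw [hA, star_eq_conjTranspose]
  have hdetW : W.det = star A.det * A.det := by rw [hWA, det_mul, det_conjTranspose]
  have hdetA : IsUnit A.det := by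
    rw [isUnit_iff_ne_zero]
    intro h
    have h0 := hW.det_pos
    rw [hdetW, h, mul_zero] at h0
    exact lt_irrefl _ h0
  set B : Matrix ι ι 𝕜 := A⁻¹ with hB
  have hAB : A * B = 1 := mul_nonsing_inv A hdetA
  have hBA : B * A = 1 := nonsing_inv_mul A hdetA
  -- `M = Bᴴ W' B ⪰ 0`, `W' = Aᴴ M A`
  set M : Matrix ι ι 𝕜 := Bᴴ * W' * B with hM
  have hMpsd : M.PosSemidef := hW'.conjTranspose_mul_mul_same B
  have hW'M : W' = Aᴴ * M * A := by
    calc W' = (B * A)ᴴ * W' * (B * A) := by rw [hBA, conjTranspose_one, Matrix.one_mul, Matrix.mul_one]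
      _ = Aᴴ * (Bᴴ * W' * B) * A := by
        rw [conjTranspose_mul]
        simp only [Matrix.mul_assoc]
  have hdetM : W'.det = M.det * W.det := by
    rw [hW'M, det_mul, det_mul, det_conjTranspose, hdetW]
    ring
  -- `W⁻¹ = B Bᴴ`, so `tr M = tr(W⁻¹ W')`
  have hWinv : W⁻¹ = B * Bᴴ := by
    apply inv_eq_left_inv
    calc B * Bᴴ * W = B * (A * B)ᴴ * A := by
          rw [hWA, conjTranspose_mul]
          simp only [Matrix.mul_assoc]
      _ = 1 := by rw [hAB, conjTranspose_one, Matrix.mul_one, hBA]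
  have htrM : M.trace = (W⁻¹ * W').trace := by
    rw [hM, hWinv, Matrix.trace_mul_cycle]
  exact ⟨A, M, hMpsd, hWA, hW'M, hdetM, htrM⟩

/-- A Hermitian matrix all of whose eigenvalues equal `1` is the identity. [folklore] -/
private theorem eq_one_of_eigenvalues_eq_one {M : Matrix ι ι 𝕜} (hM : M.IsHermitian)
    (h : ∀ i, hM.eigenvalues i = 1) : M = 1 := by
  rw [hM.spectral_theorem]
  have h' : (RCLike.ofReal ∘ hM.eigenvalues : ι → 𝕜) = fun _ => 1 :=
    funext fun i => by simp only [Function.comp_apply, h i, RCLike.ofReal_one]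
  rw [h', show (diagonal fun _ : ι => (1 : 𝕜)) = 1 from diagonal_one, map_one]

/-- A positive element of `𝕜` is the real number `re z > 0`. [folklore] -/
private theorem eq_ofReal_re_of_pos {z : 𝕜} (hz : 0 < z) :
    z = ((RCLike.re z : ℝ) : 𝕜) ∧ 0 < RCLike.re z := by
  obtain ⟨hre, him⟩ := RCLike.pos_iff.mp hz
  exact ⟨RCLike.ext (by rw [RCLike.ofReal_re]) (by rw [RCLike.ofReal_im, him]), hre⟩

/-- **THE DETERMINANT INEQUALITY BEHIND MAXIMUM-DETERMINANT COMPLETION** (strict log-concavity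
of `det` on the positive definite cone, [GJSW84, §3]; the duality (10.3)–(10.5) of [VA15]): if
`W ≻ 0`, `W' ⪰ 0` and `Re tr(W⁻¹ W') ≤ n`, then `det W' ≤ det W`, and `det W' = det W` only for
`W' = W`.  (With `W = A⋆A`: the eigenvalues `μᵢ ≥ 0` of `A⁻⋆ W' A⁻¹` have `Σ μᵢ = Re tr(W⁻¹W') ≤ n`,
so `det W' / det W = Π μᵢ ≤ 1` with equality iff all `μᵢ = 1`, i.e. `A⁻⋆ W' A⁻¹ = 1`.)
[cite: GroneEtAl1984, §3 and Thm 2 (proof)] -/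
theorem det_le_det_of_re_trace_inv_mul_le {W W' : Matrix ι ι 𝕜} (hW : W.PosDef)
    (hW' : W'.PosSemidef) (htr : RCLike.re ((W⁻¹ * W').trace) ≤ Fintype.card ι) :
    W'.det ≤ W.det ∧ (W'.det = W.det → W' = W) := by
  obtain ⟨A, M, hMpsd, hWA, hW'M, hdetM, htrM⟩ := congruence_normal_form hW hW'
  -- eigenvalues of `M`
  set μ : ι → ℝ := hMpsd.1.eigenvalues with hμ
  have hμ0 : ∀ i, 0 ≤ μ i := hMpsd.eigenvalues_nonneg
  have hdetμ : M.det = ((∏ i, μ i : ℝ) : 𝕜) := by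
    rw [hMpsd.1.det_eq_prod_eigenvalues]
    push_cast
    rfl
  have htrμ : RCLike.re M.trace = ∑ i, μ i := by
    rw [hMpsd.1.trace_eq_sum_eigenvalues, map_sum]
    simp only [RCLike.ofReal_re]
    rfl
  have hsum : ∑ i ∈ (Finset.univ : Finset ι), μ i ≤ (Finset.univ : Finset ι).card := by
    rw [Finset.card_univ, ← htrμ, htrM]
    exact htr
  obtain ⟨hle, heq⟩ := prod_le_one_of_sum_le_card Finset.univ μ (fun i _ => hμ0 i) hsum
  have hWpos := hW.det_pos
  refine ⟨?_, fun hdet => ?_⟩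
  · rw [hdetM, hdetμ]
    calc ((∏ i, μ i : ℝ) : 𝕜) * W.det ≤ ((1 : ℝ) : 𝕜) * W.det :=
          mul_le_mul_of_nonneg_right (RCLike.ofReal_le_ofReal.mpr hle) hWpos.le
      _ = W.det := by rw [RCLike.ofReal_one, one_mul]
  · have hM1 : M.det = 1 := by
      have h : M.det * W.det = 1 * W.det := by rw [← hdetM, one_mul, hdet]
      exact mul_right_cancel₀ hWpos.ne' h
    have hprod1 : ∏ i, μ i = 1 := by
      have h : ((∏ i, μ i : ℝ) : 𝕜) = ((1 : ℝ) : 𝕜) := by rw [← hdetμ, hM1, RCLike.ofReal_one]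
      exact RCLike.ofReal_injective h
    have hMone : M = 1 :=
      eq_one_of_eigenvalues_eq_one hMpsd.1 fun i => heq hprod1 i (Finset.mem_univ i)
    rw [hW'M, hMone, Matrix.mul_one, hWA]

/-- **CONCAVITY OF `log det`: THE GRADIENT INEQUALITY / NONNEGATIVITY OF THE MAX-DET DUALITY GAP**
([VBW98, §3, eq. (3.2) and the remark after Thm 3.1]: `Tr(G(x)W) - log det(G(x)W) - l ≥ 0`, "zero
duality gap implies `G(x)W = I`"; `∇ log det X = X⁻¹`): for `W ≻ 0`, `W' ≻ 0`,
`log det W' - log det W ≤ Re tr(W⁻¹ W') - n`, with equality only for `W' = W`.  (Eigenvalues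
`μᵢ > 0` of `A⁻⋆ W' A⁻¹` where `W = A⋆A`: `Σ log μᵢ ≤ Σ (μᵢ - 1)`.)  Determinants of positive
definite matrices over `𝕜 = ℝ, ℂ` are real; the statement is about their real parts.
[cite: VandenbergheBoydWu1998, §3 eq. (3.2) and Thm 3.1 (remark)] -/
theorem log_det_sub_log_det_le {W W' : Matrix ι ι 𝕜} (hW : W.PosDef) (hW' : W'.PosDef) :
    Real.log (RCLike.re W'.det) - Real.log (RCLike.re W.det) ≤
        RCLike.re ((W⁻¹ * W').trace) - Fintype.card ι ∧
      (Real.log (RCLike.re W'.det) - Real.log (RCLike.re W.det) =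
          RCLike.re ((W⁻¹ * W').trace) - Fintype.card ι → W' = W) := by
  obtain ⟨A, M, hMpsd, hWA, hW'M, hdetM, htrM⟩ := congruence_normal_form hW hW'.posSemidef
  set μ : ι → ℝ := hMpsd.1.eigenvalues with hμ
  have hμ0 : ∀ i, 0 ≤ μ i := hMpsd.eigenvalues_nonneg
  have hdetμ : M.det = ((∏ i, μ i : ℝ) : 𝕜) := by
    rw [hMpsd.1.det_eq_prod_eigenvalues]
    push_cast
    rfl
  have htrμ : RCLike.re M.trace = ∑ i, μ i := by
    rw [hMpsd.1.trace_eq_sum_eigenvalues, map_sum]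
    simp only [RCLike.ofReal_re]
    rfl
  -- the determinants are the positive reals `re det W`, `re det W' = (Π μ) · re det W`
  obtain ⟨hWre, hWpos⟩ := eq_ofReal_re_of_pos hW.det_pos
  obtain ⟨-, hW'pos⟩ := eq_ofReal_re_of_pos hW'.det_pos
  have hre : RCLike.re W'.det = (∏ i, μ i) * RCLike.re W.det := by
    rw [hdetM, hdetμ, RCLike.re_ofReal_mul]
  have hprodpos : 0 < ∏ i, μ i := by
    by_contra h
    have h' : RCLike.re W'.det ≤ 0 := by
      rw [hre]
      exact mul_nonpos_iff.mpr (Or.inr ⟨not_lt.mp h, hWpos.le⟩)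
    exact absurd hW'pos (not_lt.mpr h')
  have hμne : ∀ i ∈ (Finset.univ : Finset ι), μ i ≠ 0 := fun i _ h => by
    have h0 := hprodpos
    rw [Finset.prod_eq_zero (Finset.mem_univ i) h] at h0
    exact lt_irrefl _ h0
  have hμpos : ∀ i ∈ (Finset.univ : Finset ι), 0 < μ i := fun i hi =>
    lt_of_le_of_ne (hμ0 i) (hμne i hi).symm
  -- `log det W' - log det W = Σ log μ`, `Re tr(W⁻¹ W') - n = Σ (μ - 1)`
  have hlog : Real.log (RCLike.re W'.det) - Real.log (RCLike.re W.det) = ∑ i, Real.log (μ i) := by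
    rw [hre, Real.log_mul hprodpos.ne' hWpos.ne', Real.log_prod hμne]
    ring
  have htr : RCLike.re ((W⁻¹ * W').trace) - Fintype.card ι = ∑ i, (μ i - 1) := by
    rw [← htrM, htrμ, Finset.sum_sub_distrib, Finset.sum_const, Finset.card_univ, nsmul_eq_mul,
      mul_one]
  obtain ⟨hle, heq⟩ := sum_log_le_sum_sub_one Finset.univ μ hμpos
  rw [hlog, htr]
  refine ⟨hle, fun h => ?_⟩
  have hMone : M = 1 := eq_one_of_eigenvalues_eq_one hMpsd.1 fun i => heq h i (Finset.mem_univ i)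
  rw [hW'M, hMone, Matrix.mul_one, hWA]

end Determinant


/-! ### One column of the inverse factorization `W L = L⁻⋆ D⁻¹` -/

section InverseStep

variable [Fintype ι] [DecidableEq ι]

omit [DecidableEq ι] in
/-- `M c` at a row, as a sum over the support of `c`. [folklore] -/
private theorem mulVec_apply_eq_sum_of_support' {N : Finset ι} {c : ι → 𝕜}
    (hc : ∀ i, i ∉ N → c i = 0) (M : Matrix ι ι 𝕜) (j : ι) :
    (M *ᵥ c) j = ∑ k ∈ N, M j k * c k := by
  simp only [Matrix.mulVec, dotProduct]
  exact (Finset.sum_subset (Finset.subset_univ N) fun k _ hk => by rw [hc k hk, mul_zero]).symm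

omit [DecidableEq ι] in
/-- `c⋆ w` as a sum over the support of `c`. [folklore] -/
private theorem star_dotProduct_eq_sum_of_support' {N : Finset ι} {c : ι → 𝕜}
    (hc : ∀ i, i ∉ N → c i = 0) (w : ι → 𝕜) :
    star c ⬝ᵥ w = ∑ k ∈ N, star (c k) * w k := by
  simp only [dotProduct, Pi.star_apply]
  exact (Finset.sum_subset (Finset.subset_univ N) fun k _ hk => by
    rw [hc k hk, star_zero, zero_mul]).symm

/-- THE COLUMN EQUATION OF THE INVERSE FACTORIZATION ([VA15, (10.6)]: the `γ_j × ν_j` block of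
`W L = L⁻ᵀ D⁻¹` reads `[A_νν, A_ανᵀ; A_αν, A_αα] [I; L_αν] = [D_νν⁻¹; 0]` with
`L_αν = -A_αα⁻¹ A_αν`, `D_νν⁻¹ = A_νν - A_ανᵀ A_αα⁻¹ A_αν`): if `P` (supported away from row and
column `a`) is bordered by the column `u = P c` and the diagonal entry `d`, then the bordered
matrix maps `ℓ = e_a - c` to `(d - c⋆ P c) e_a`.
[cite: VandenbergheAndersen2015, §10.2 eq. (10.6)–(10.7)] -/
theorem border_mulVec_single_sub {P : Matrix ι ι 𝕜} (hP : P.PosSemidef) {s : Finset ι} {a : ι}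
    (has : a ∉ s) (hP0 : ∀ i j, i ∉ s ∨ j ∉ s → P i j = 0) {c : ι → 𝕜}
    (hc : ∀ i, i ∉ s → c i = 0) (d : 𝕜) :
    border P a d (P *ᵥ c) *ᵥ ((Pi.single a 1 : ι → 𝕜) - c) =
      (d - star c ⬝ᵥ (P *ᵥ c)) • (Pi.single a 1 : ι → 𝕜) := by
  set e : ι → 𝕜 := Pi.single a 1 with he
  set u : ι → 𝕜 := P *ᵥ c with hu
  have hca : c a = 0 := hc a has
  have hua : u a = 0 := by
    rw [hu]
    simp only [Matrix.mulVec, dotProduct]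
    exact Finset.sum_eq_zero fun j _ => by rw [hP0 a j (Or.inl has), zero_mul]
  have hγsa : IsSelfAdjoint (star c ⬝ᵥ u) := IsSelfAdjoint.of_nonneg (hP.dotProduct_mulVec_nonneg c)
  -- column `a` of the bordered matrix
  have hWe : border P a d u *ᵥ e = d • e + u := by
    rw [he, Matrix.mulVec_single_one]
    ext i
    simp only [Matrix.col_apply, Pi.add_apply, Pi.smul_apply, smul_eq_mul]
    by_cases hi : i = a
    · rw [hi, border_apply_same d (hP0 a a (Or.inl has)) hua, Pi.single_eq_same, mul_one, hua,
        add_zero]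
    · rw [border_apply_col d u hi (hP0 i a (Or.inr has)), Pi.single_eq_of_ne hi, mul_zero,
        zero_add]
  -- the bordered matrix applied to `c`
  have hWc : border P a d u *ᵥ c = u + (star c ⬝ᵥ u) • e := by
    have h1 : (d • e + star u) ⬝ᵥ c = star c ⬝ᵥ u := by
      rw [add_dotProduct, smul_dotProduct, he, single_one_dotProduct, hca, smul_zero, zero_add,
        star_dotProduct, hγsa.star_eq]
    have h2 : e ⬝ᵥ c = 0 := by rw [he, single_one_dotProduct, hca]
    rw [border, Matrix.add_mulVec, Matrix.add_mulVec, vecMulVec_mulVec, vecMulVec_mulVec, h1, h2,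
      ← hu, MulOpposite.op_zero, zero_smul, add_zero, op_smul_eq_smul]
  rw [Matrix.mulVec_sub, hWe, hWc, sub_smul]
  abel

/-- ONE STEP OF THE INVERSE RECURSION ([VA15, Algorithm 10.1]; the factorization `W⁻¹ = L D Lᵀ`
accumulated one column at a time): if `K P = 1_s` (the identity on the coordinates in `s`) with
`K`, `P` supported on `s × s`, `a ∉ s`, `c` supported on `s` and `σ = d - c⋆ P c ≠ 0`, then
`(K + σ⁻¹ ℓ ℓ⋆) W = 1_{s ∪ {a}}` for the bordered matrix `W = border P a d (P c)` and `ℓ = e_a - c`.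
[cite: VandenbergheAndersen2015, §10.2 eq. (10.6)–(10.7) and Algorithm 10.1] -/
theorem inverse_border_step {P K : Matrix ι ι 𝕜} (hP : P.PosSemidef) {s : Finset ι} {a : ι}
    (has : a ∉ s) (hP0 : ∀ i j, i ∉ s ∨ j ∉ s → P i j = 0)
    (hK0 : ∀ i j, i ∉ s ∨ j ∉ s → K i j = 0)
    (hKP : K * P = diagonal (fun i => if i ∈ s then (1 : 𝕜) else 0)) {c : ι → 𝕜}
    (hc : ∀ i, i ∉ s → c i = 0) {d : 𝕜} (hd : IsSelfAdjoint d)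
    (hσ : d - star c ⬝ᵥ (P *ᵥ c) ≠ 0)
    (hW : (border P a d (P *ᵥ c)).IsHermitian) :
    (K + (d - star c ⬝ᵥ (P *ᵥ c))⁻¹ •
        vecMulVec ((Pi.single a 1 : ι → 𝕜) - c) (star ((Pi.single a 1 : ι → 𝕜) - c))) *
      border P a d (P *ᵥ c) = diagonal (fun i => if i ∈ insert a s then (1 : 𝕜) else 0) := by
  set e : ι → 𝕜 := Pi.single a 1 with he
  set u : ι → 𝕜 := P *ᵥ c with hu
  set σ : 𝕜 := d - star c ⬝ᵥ u with hσdef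
  set ℓ : ι → 𝕜 := e - c with hℓ
  have hσsa : IsSelfAdjoint σ :=
    hd.sub (IsSelfAdjoint.of_nonneg (hP.dotProduct_mulVec_nonneg c))
  -- `W ℓ = σ e_a`, hence `ℓ⋆ W = σ e_aᵀ`
  have hWℓ : border P a d u *ᵥ ℓ = σ • e := border_mulVec_single_sub hP has hP0 hc d
  have hℓW : star ℓ ᵥ* border P a d u = σ • e := by
    rw [← hW.eq, ← Matrix.star_mulVec, hWℓ, star_smul, hσsa.star_eq, he, Pi.star_single,
      star_one]
  -- `K e_a = 0`, `K u = K P c = 1_s c = c`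
  have hKe : K *ᵥ e = 0 := by
    rw [he, Matrix.mulVec_single_one]
    ext i
    exact hK0 i a (Or.inr has)
  have hKu : K *ᵥ u = c := by
    rw [hu, Matrix.mulVec_mulVec, hKP]
    ext i
    rw [mulVec_diagonal]
    by_cases hi : i ∈ s
    · rw [if_pos hi, one_mul]
    · rw [if_neg hi, zero_mul, hc i hi]
  have hKW : K * border P a d u = diagonal (fun i => if i ∈ s then (1 : 𝕜) else 0) +
      vecMulVec c e := by
    rw [border, Matrix.mul_add, Matrix.mul_add, mul_vecMulVec, mul_vecMulVec, hKP, hKe, hKu,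
      zero_vecMulVec, zero_add]
  have hLW : (σ⁻¹ • vecMulVec ℓ (star ℓ)) * border P a d u = vecMulVec e e - vecMulVec c e := by
    rw [Matrix.smul_mul, vecMulVec_mul, hℓW, vecMulVec_smul, smul_smul, inv_mul_cancel₀ hσ,
      one_smul, hℓ, sub_vecMulVec]
  rw [Matrix.add_mul, hKW, hLW]
  -- `1_s + e_a e_aᵀ = 1_{insert a s}`
  ext i j
  simp only [Matrix.add_apply, Matrix.sub_apply, diagonal_apply, vecMulVec_apply, Finset.mem_insert]
  by_cases hij : i = j
  · subst hij
    by_cases hia : i = a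
    · subst hia
      rw [if_pos rfl, if_pos rfl, if_neg has, if_pos (Or.inl rfl), he, Pi.single_eq_same]
      ring
    · rw [if_pos rfl, if_pos rfl, he, Pi.single_eq_of_ne hia]
      simp [hia]
  · rw [if_neg hij, if_neg hij]
    by_cases hia : i = a
    · have hja : j ≠ a := fun h => hij (hia.trans h.symm)
      rw [he, Pi.single_eq_of_ne hja]
      ring
    · rw [he, Pi.single_eq_of_ne hia]
      ring

end InverseStep


/-! ### Maximum-determinant completion: the characterisation by the inverse pattern -/

section InversePattern

variable [Fintype ι] [DecidableEq ι]

omit [DecidableEq ι] in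
/-- If `W⁻¹` (or any `C`) has pattern `E` and `W'` agrees with `W` on the diagonal and on `E`
(a symmetric pattern), then `tr(C W') = tr(C W)` — the trace pairing only sees the prescribed
entries ([GJSW84, (3.3)]: the gradient `∇ det = det · B⁻¹` of the maximiser vanishes on the free
coordinates). [cite: GroneEtAl1984, §3 eq. (3.3) and Thm 2 (proof)] -/
theorem trace_mul_eq_of_hasPattern_of_agree {E : ι → ι → Prop} (hEs : ∀ ⦃i j : ι⦄, E i j → E j i)
    {C W W' : Matrix ι ι 𝕜} (hC : HasPattern E C)
    (hagree : ∀ i j, (i = j ∨ E i j) → W' i j = W i j) : (C * W').trace = (C * W).trace := by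
  simp only [Matrix.trace, Matrix.diag, Matrix.mul_apply]
  refine Finset.sum_congr rfl fun i _ => Finset.sum_congr rfl fun j _ => ?_
  by_cases hij : i = j
  · rw [hagree j i (Or.inl hij.symm)]
  · by_cases hE : E i j
    · rw [hagree j i (Or.inr (hEs hE))]
    · rw [hC hij hE, zero_mul, zero_mul]

/-- **A POSITIVE DEFINITE COMPLETION WHOSE INVERSE HAS THE PATTERN MAXIMISES THE DETERMINANT,
UNIQUELY** (the "furthermore" of [GJSW84, Thm 2] = [FKMN01, Thm 2.4]; Dempster's covariance
selection; the optimality conditions (10.5) `Π_E(W) = A, W ≻ 0, W⁻¹ = Y ∈ 𝐒ⁿ_E` of [VA15]), for an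
ARBITRARY symmetric pattern `E`: if `W ≻ 0`, `W⁻¹` has sparsity pattern `E`, and `W' ⪰ 0` agrees
with `W` on the diagonal and on `E`, then `det W' ≤ det W`, with equality only for `W' = W`.
(`tr(W⁻¹ W') = tr(W⁻¹ W) = n` by `trace_mul_eq_of_hasPattern_of_agree`, then
`det_le_det_of_re_trace_inv_mul_le`.) [cite: GroneEtAl1984, Thm 2] -/
theorem det_le_det_of_inv_hasPattern {E : ι → ι → Prop} (hEs : ∀ ⦃i j : ι⦄, E i j → E j i)
    {W W' : Matrix ι ι 𝕜} (hW : W.PosDef) (hWinv : HasPattern E W⁻¹) (hW' : W'.PosSemidef)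
    (hagree : ∀ i j, (i = j ∨ E i j) → W' i j = W i j) :
    W'.det ≤ W.det ∧ (W'.det = W.det → W' = W) := by
  refine det_le_det_of_re_trace_inv_mul_le hW hW' (le_of_eq ?_)
  have hdet : IsUnit W.det := (isUnit_iff_isUnit_det W).mp hW.isUnit
  rw [trace_mul_eq_of_hasPattern_of_agree hEs hWinv hagree, nonsing_inv_mul W hdet, trace_one,
    RCLike.natCast_re]

/-- **UNIQUENESS OF THE POSITIVE DEFINITE COMPLETION WITH INVERSE IN THE PATTERN**
([GJSW84, Thm 2]; [FKMN01, Thm 2.4]: `X̂` "is characterized by the condition `[X̂⁻¹]_{ij} = 0`,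
`(i,j) ∉ F`"), for an arbitrary symmetric pattern `E`: two positive definite matrices that agree
on the diagonal and on `E` and both have inverses with pattern `E` are equal.
[cite: GroneEtAl1984, Thm 2] -/
theorem eq_of_posDef_of_inv_hasPattern {E : ι → ι → Prop} (hEs : ∀ ⦃i j : ι⦄, E i j → E j i)
    {W₁ W₂ : Matrix ι ι 𝕜} (h₁ : W₁.PosDef) (h₁inv : HasPattern E W₁⁻¹) (h₂ : W₂.PosDef)
    (h₂inv : HasPattern E W₂⁻¹) (hagree : ∀ i j, (i = j ∨ E i j) → W₁ i j = W₂ i j) :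
    W₁ = W₂ := by
  obtain ⟨h12, heq⟩ := det_le_det_of_inv_hasPattern hEs h₂ h₂inv h₁.posSemidef hagree
  obtain ⟨h21, -⟩ := det_le_det_of_inv_hasPattern hEs h₁ h₁inv h₂.posSemidef
    fun i j hij => (hagree i j hij).symm
  exact heq (le_antisymm h12 h21)

/-- **PARAMETRIZATION OF ALL POSITIVE DEFINITE COMPLETIONS BY THE FREE ENTRIES OF THE INVERSE**
([VBW98, §2.2, (2.2)–(2.3)]: "a positive definite completion `A(x)` is uniquely characterized by
specifying the elements of its inverse in the free locations"; the case `C = 0` is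
`eq_of_posDef_of_inv_hasPattern`), for an arbitrary symmetric pattern `E`: two positive definite
matrices that agree on the prescribed entries (diagonal and `E`) and whose INVERSES agree on the
free entries are equal.  (Summing the two gradient inequalities `log_det_sub_log_det_le`:
`tr(W₂⁻¹W₁) + tr(W₁⁻¹W₂) = tr(W₂⁻¹W₂) + tr(W₁⁻¹W₁) = 2n` entrywise, so both are equalities.)
[cite: VandenbergheBoydWu1998, §2.2 eq. (2.2)–(2.3)] -/
theorem eq_of_posDef_of_inv_agree_off_pattern {E : ι → ι → Prop}
    (hEs : ∀ ⦃i j : ι⦄, E i j → E j i) {W₁ W₂ : Matrix ι ι 𝕜} (h₁ : W₁.PosDef) (h₂ : W₂.PosDef)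
    (hagree : ∀ i j, (i = j ∨ E i j) → W₁ i j = W₂ i j)
    (hinv : ∀ i j, ¬(i = j ∨ E i j) → W₁⁻¹ i j = W₂⁻¹ i j) : W₁ = W₂ := by
  -- entrywise: `tr(W₂⁻¹ W₁) + tr(W₁⁻¹ W₂) = tr(W₂⁻¹ W₂) + tr(W₁⁻¹ W₁)`
  have hsum : (W₂⁻¹ * W₁).trace + (W₁⁻¹ * W₂).trace = (W₂⁻¹ * W₂).trace + (W₁⁻¹ * W₁).trace := by
    simp only [Matrix.trace, Matrix.diag, Matrix.mul_apply]
    rw [← Finset.sum_add_distrib, ← Finset.sum_add_distrib]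
    refine Finset.sum_congr rfl fun i _ => ?_
    rw [← Finset.sum_add_distrib, ← Finset.sum_add_distrib]
    refine Finset.sum_congr rfl fun j _ => ?_
    by_cases hP : i = j ∨ E i j
    · rw [hagree j i (hP.imp Eq.symm fun h => hEs h)]
    · rw [hinv i j hP, add_comm]
  have hu₁ : IsUnit W₁.det := (isUnit_iff_isUnit_det W₁).mp h₁.isUnit
  have hu₂ : IsUnit W₂.det := (isUnit_iff_isUnit_det W₂).mp h₂.isUnit
  rw [nonsing_inv_mul W₂ hu₂, nonsing_inv_mul W₁ hu₁, trace_one] at hsum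
  have hre : RCLike.re ((W₂⁻¹ * W₁).trace) + RCLike.re ((W₁⁻¹ * W₂).trace) =
      (Fintype.card ι : ℝ) + Fintype.card ι := by
    have h := congrArg RCLike.re hsum
    rwa [map_add, map_add, RCLike.natCast_re] at h
  obtain ⟨h12, heq12⟩ := log_det_sub_log_det_le h₂ h₁
  obtain ⟨h21, -⟩ := log_det_sub_log_det_le h₁ h₂
  exact heq12 (by linarith)

end InversePattern

/-! ### Existence for chordal patterns: the inverse completion factorization -/

section Existence

variable [Fintype ι] [LinearOrder ι]

/-- RECURSIVE MAXIMUM-DETERMINANT COMPLETION ALONG A PERFECT ELIMINATION ORDERING (the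
constructive existence proof of [VA15, §10.2]: "if `E` is chordal, the Cholesky factors of
`W⁻¹ = Y` can be computed directly from `A` … this also gives a constructive proof that (10.3) is
solvable for all `A ∈ Π_E(𝐒ⁿ₊₊)`", Algorithm 10.1; [FKMN01, §2.3]: "a recursive application of
Lemma 2.6 in accordance with the perfect elimination ordering", the sparse factorization formula
(2.10)).  For a symmetric monotone-transitive pattern `E` and a finite vertex set `S`: if for every
`v ∈ S` some positive DEFINITE matrix agrees with `X` on `(col(v) ∩ S)²`, then there are `W ⪰ 0`
and `K`, both supported on `S × S`, with `W = X` on the prescribed entries inside `S × S`, `K` of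
sparsity pattern `E`, and `K W = 1_S` (so on `S = univ`: `W ≻ 0` and `W⁻¹ = K ∈ 𝐒ⁿ_E`).  The step
`S = {a} ∪ s` (`a` lowest): complete on `s` to `(P, K)`, border `P` by `u = P c` (`c` supported on
`adj⁺(a) ∩ S` solving `X[N,N] c = X[N,a]`), and add the column `ℓ = e_a - c` of `L`:
`K' = K + σ⁻¹ ℓ ℓ⋆`, `σ = X_aa - c⋆ P c > 0` (`inverse_border_step`).
[cite: VandenbergheAndersen2015, §10.2 eq. (10.6)–(10.7) and Algorithm 10.1] -/
theorem exists_completion_and_inverse_of_subset {E : ι → ι → Prop}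
    (hEs : ∀ ⦃i j : ι⦄, E i j → E j i) (hEm : MonotoneTransitive E) (X : Matrix ι ι 𝕜)
    (S : Finset ι) :
    (∀ v ∈ S, ∃ G : Matrix ι ι 𝕜, G.PosDef ∧
        ∀ i ∈ S, i ∈ clique E v → ∀ j ∈ S, j ∈ clique E v → G i j = X i j) →
      ∃ W K : Matrix ι ι 𝕜, W.PosSemidef ∧ (∀ i j, i ∉ S ∨ j ∉ S → W i j = 0) ∧
        (∀ i ∈ S, ∀ j ∈ S, (i = j ∨ E i j) → W i j = X i j) ∧
        (∀ i j, i ∉ S ∨ j ∉ S → K i j = 0) ∧ HasPattern E K ∧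
        K * W = diagonal (fun i => if i ∈ S then (1 : 𝕜) else 0) := by
  induction S using Finset.induction_on_min with
  | empty =>
    intro _
    refine ⟨0, 0, PosSemidef.zero, fun _ _ _ => rfl, fun i hi => absurd hi (Finset.notMem_empty i),
      fun _ _ _ => rfl, fun _ _ _ _ => rfl, ?_⟩
    ext i j
    simp [diagonal_apply]
  | insert a s hlt ih =>
    intro hloc
    -- complete on `s` by induction
    obtain ⟨P, K, hP, hP0, hPX, hK0, hKE, hKP⟩ := ih fun v hv => by
      obtain ⟨G, hG, hGX⟩ := hloc v (Finset.mem_insert_of_mem hv)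
      exact ⟨G, hG, fun i hi hiv j hj hjv =>
        hGX i (Finset.mem_insert_of_mem hi) hiv j (Finset.mem_insert_of_mem hj) hjv⟩
    -- the clique block of the lowest vertex `a`
    obtain ⟨G, hG, hGX⟩ := hloc a (Finset.mem_insert_self a s)
    have has : a ∉ s := fun h => lt_irrefl a (hlt a h)
    classical
    -- the higher neighbourhood of `a` inside `S`
    set N : Finset ι := s.filter (fun j => E a j) with hN
    have hNmem : ∀ {j}, j ∈ N ↔ j ∈ s ∧ E a j := by
      intro j
      rw [hN, Finset.mem_filter]
    have hNclq : ∀ {j}, j ∈ N → j ∈ clique E a := fun hj =>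
      mem_clique_iff.mpr (Or.inr ⟨hlt _ (hNmem.mp hj).1, (hNmem.mp hj).2⟩)
    have hNS : ∀ {j}, j ∈ N → j ∈ insert a s := fun hj =>
      Finset.mem_insert_of_mem (hNmem.mp hj).1
    have haS : a ∈ insert a s := Finset.mem_insert_self a s
    have haC : a ∈ clique E a := mem_clique_self E a
    have haN : a ∉ N := fun h => has (hNmem.mp h).1
    -- `G` agrees with `X` on `({a} ∪ N) × ({a} ∪ N)`, `P` agrees with `X` on `N × N`
    have hGaa : G a a = X a a := hGX a haS haC a haS haC
    have hGNa : ∀ {j}, j ∈ N → G j a = X j a := fun hj => hGX _ (hNS hj) (hNclq hj) a haS haC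
    have hGaN : ∀ {j}, j ∈ N → G a j = X a j := fun hj => hGX a haS haC _ (hNS hj) (hNclq hj)
    have hGNN : ∀ {j k}, j ∈ N → k ∈ N → G j k = X j k := fun hj hk =>
      hGX _ (hNS hj) (hNclq hj) _ (hNS hk) (hNclq hk)
    have hPNN : ∀ {j k}, j ∈ N → k ∈ N → P j k = X j k := fun {j k} hj hk => by
      refine hPX j (hNmem.mp hj).1 k (hNmem.mp hk).1 ?_
      by_cases hjk : j = k
      · exact Or.inl hjk
      · exact Or.inr (clique_complete hEs hEm a (hNclq hj) (hNclq hk) hjk)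
    have hXaj : ∀ {j}, j ∈ N → star (X j a) = X a j := fun hj => by
      rw [← hGNa hj, hG.1.apply, hGaN hj]
    -- `c` from the range condition in `G`, supported on `N ⊆ s`
    obtain ⟨c, hc0, hGc⟩ := exists_mulVec_eq_col_of_posSemidef hG.posSemidef N a
    have hcs : ∀ i, i ∉ s → c i = 0 := fun i hi => hc0 i fun h => hi (hNmem.mp h).1
    have hPc_out : ∀ i, i ∉ s → (P *ᵥ c) i = 0 := fun i hi => by
      simp only [Matrix.mulVec, dotProduct]
      exact Finset.sum_eq_zero fun k _ => by rw [hP0 i k (Or.inl hi), zero_mul]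
    have hPcN : ∀ {j}, j ∈ N → (P *ᵥ c) j = X j a := fun {j} hj => by
      rw [← hGNa hj, ← hGc j hj, mulVec_apply_eq_sum_of_support' hc0,
        mulVec_apply_eq_sum_of_support' hc0]
      exact Finset.sum_congr rfl fun k hk => by rw [hPNN hj hk, hGNN hj hk]
    -- `γ = c⋆ P c = c⋆ G c = c⋆ G e_a = (e_a⋆ G c)⋆`
    have hγ : star c ⬝ᵥ (P *ᵥ c) = ∑ k ∈ N, star (c k) * G k a := by
      rw [star_dotProduct_eq_sum_of_support' hc0]
      exact Finset.sum_congr rfl fun k hk => by rw [hPcN hk, hGNa hk]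
    have hγG : star c ⬝ᵥ (G *ᵥ c) = ∑ k ∈ N, star (c k) * G k a := by
      rw [star_dotProduct_eq_sum_of_support' hc0]
      exact Finset.sum_congr rfl fun k hk => by rw [hGc k hk]
    have hcGa : star c ⬝ᵥ (G.col a) = ∑ k ∈ N, star (c k) * G k a := by
      rw [star_dotProduct_eq_sum_of_support' hc0]
      rfl
    have hGca : star ((G *ᵥ c) a) = ∑ k ∈ N, star (c k) * G k a := by
      rw [mulVec_apply_eq_sum_of_support' hc0, star_sum]
      exact Finset.sum_congr rfl fun k _ => by rw [star_mul, hG.1.apply]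
    -- `(e_a - c)⋆ G (e_a - c) = G_aa - (G c)_a > 0` since `e_a - c ≠ 0` and `G ≻ 0`
    have hq : star ((Pi.single a 1 : ι → 𝕜) - c) ⬝ᵥ (G *ᵥ ((Pi.single a 1 : ι → 𝕜) - c)) =
        G a a - (G *ᵥ c) a := by
      rw [star_sub, Pi.star_single, star_one, Matrix.mulVec_sub, Matrix.mulVec_single_one,
        sub_dotProduct, dotProduct_sub, dotProduct_sub, single_one_dotProduct,
        single_one_dotProduct, hcGa, hγG, sub_self, sub_zero]
      rfl
    have hne : (Pi.single a 1 : ι → 𝕜) - c ≠ 0 := fun h => by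
      have h1 := congr_fun h a
      rw [Pi.sub_apply, Pi.single_eq_same, hc0 a haN, sub_zero] at h1
      exact one_ne_zero h1
    have hq0 : 0 < G a a - (G *ᵥ c) a := by
      rw [← hq]
      exact hG.dotProduct_mulVec_pos hne
    have hσ : 0 < X a a - star c ⬝ᵥ (P *ᵥ c) := by
      have h1 : X a a - star c ⬝ᵥ (P *ᵥ c) = star (G a a - (G *ᵥ c) a) := by
        rw [star_sub, hG.1.apply a a, hGaa, hγ, hGca]
      rw [h1, (IsSelfAdjoint.of_nonneg hq0.le).star_eq]
      exact hq0
    have hdsa : IsSelfAdjoint (X a a) := by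
      rw [← hGaa]
      exact hG.1.apply a a
    have hW : (border P a (X a a) (P *ᵥ c)).PosSemidef := posSemidef_border hP a hdsa c hσ.le
    -- supports of `ℓ = e_a - c`: inside `insert a s` and inside `col(a)`
    have hℓS : ∀ i, i ∉ insert a s → ((Pi.single a 1 : ι → 𝕜) - c) i = 0 := fun i hi => by
      have hia : i ≠ a := fun h => hi (h ▸ haS)
      rw [Pi.sub_apply, Pi.single_eq_of_ne hia,
        hcs i fun h => hi (Finset.mem_insert_of_mem h), sub_zero]
    have hℓC : ∀ i, i ∉ clique E a → ((Pi.single a 1 : ι → 𝕜) - c) i = 0 := fun i hi => by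
      have hia : i ≠ a := fun h => hi (h ▸ haC)
      rw [Pi.sub_apply, Pi.single_eq_of_ne hia, hc0 i fun h => hi (hNclq h), sub_zero]
    refine ⟨border P a (X a a) (P *ᵥ c),
      K + (X a a - star c ⬝ᵥ (P *ᵥ c))⁻¹ •
        vecMulVec ((Pi.single a 1 : ι → 𝕜) - c) (star ((Pi.single a 1 : ι → 𝕜) - c)),
      hW, fun i j hij => ?_, fun i hi j hj hij => ?_, fun i j hij => ?_, fun i j hij hE => ?_,
      inverse_border_step hP has hP0 hK0 hKP hcs hdsa hσ.ne' hW.1⟩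
    · -- support of `W` on `insert a s`
      rcases hij with hi | hj
      · have hia : i ≠ a := fun h => hi (h ▸ haS)
        have his : i ∉ s := fun h => hi (Finset.mem_insert_of_mem h)
        simp [border_apply, hP0 i j (Or.inl his), Pi.single_eq_of_ne hia, hPc_out i his]
      · have hja : j ≠ a := fun h => hj (h ▸ haS)
        have hjs : j ∉ s := fun h => hj (Finset.mem_insert_of_mem h)
        simp [border_apply, hP0 i j (Or.inr hjs), Pi.single_eq_of_ne hja, hPc_out j hjs]
    · -- the prescribed entries
      rcases Finset.mem_insert.mp hi with hia | hi'
      · rw [hia] at hij ⊢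
        rcases Finset.mem_insert.mp hj with hja | hj'
        · rw [hja]
          exact border_apply_same (X a a) (hP0 a a (Or.inl has)) (hPc_out a has)
        · have hja : j ≠ a := fun h => has (h ▸ hj')
          have hE : E a j := hij.resolve_left fun h => hja h.symm
          rw [border_apply_row (X a a) (P *ᵥ c) hja (hP0 a j (Or.inl has)),
            hPcN (hNmem.mpr ⟨hj', hE⟩), hXaj (hNmem.mpr ⟨hj', hE⟩)]
      · have hia : i ≠ a := fun h => has (h ▸ hi')
        rcases Finset.mem_insert.mp hj with hja | hj'
        · rw [hja] at hij ⊢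
          have hE : E a i := hEs (hij.resolve_left hia)
          rw [border_apply_col (X a a) (P *ᵥ c) hia (hP0 i a (Or.inr has)),
            hPcN (hNmem.mpr ⟨hi', hE⟩)]
        · rw [border_apply_of_ne P (X a a) (P *ᵥ c) hia (fun h => has (h ▸ hj'))]
          exact hPX i hi' j hj' hij
    · -- support of `K'` on `insert a s`
      rw [Matrix.add_apply, Matrix.smul_apply, vecMulVec_apply, Pi.star_apply]
      rcases hij with hi | hj
      · rw [hK0 i j (Or.inl fun h => hi (Finset.mem_insert_of_mem h)), hℓS i hi]
        simp
      · rw [hK0 i j (Or.inr fun h => hj (Finset.mem_insert_of_mem h)), hℓS j hj]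
        simp
    · -- `K'` has pattern `E`: `ℓ ℓ⋆` lives on the complete block `col(a) × col(a)`
      rw [Matrix.add_apply, Matrix.smul_apply, vecMulVec_apply, Pi.star_apply, hKE hij hE]
      by_cases hi : i ∈ clique E a
      · by_cases hj : j ∈ clique E a
        · exact absurd (clique_complete hEs hEm a hi hj hij) hE
        · rw [hℓC j hj]
          simp
      · rw [hℓC i hi]
        simp

/-- PADDING A POSITIVE DEFINITE BLOCK: if the principal submatrix `X[C,C]` is positive definite,
the block matrix `X[C,C] ⊕ I` is a positive definite matrix agreeing with `X` on `C × C`.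
[folklore] -/
private theorem exists_posDef_of_submatrix_posDef (C : Set ι) [DecidablePred (· ∈ C)]
    {X : Matrix ι ι 𝕜} (hX : (X.submatrix (Subtype.val : C → ι) Subtype.val).PosDef) :
    ∃ G : Matrix ι ι 𝕜, G.PosDef ∧ ∀ i ∈ C, ∀ j ∈ C, G i j = X i j := by
  classical
  set A : Matrix C C 𝕜 := X.submatrix Subtype.val Subtype.val with hA
  set B : Matrix (C ⊕ {i // i ∉ C}) (C ⊕ {i // i ∉ C}) 𝕜 :=
    fromBlocks A 0 0 (1 : Matrix {i // i ∉ C} {i // i ∉ C} 𝕜) with hB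
  have hBH : B.IsHermitian :=
    IsHermitian.fromBlocks hX.1 (by rw [conjTranspose_zero]) isHermitian_one
  have hBpd : B.PosDef := by
    refine PosDef.of_dotProduct_mulVec_pos hBH fun x hx => ?_
    have hx' : x ∘ Sum.inl ≠ 0 ∨ x ∘ Sum.inr ≠ 0 := by
      by_contra h
      push Not at h
      apply hx
      funext i
      cases i with
      | inl j => exact congr_fun h.1 j
      | inr j => exact congr_fun h.2 j
    have hxe : x = Sum.elim (x ∘ Sum.inl) (x ∘ Sum.inr) := (Sum.elim_comp_inl_inr x).symm
    have key : ∀ (y : C → 𝕜) (z : {i // i ∉ C} → 𝕜),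
        star (Sum.elim y z) ⬝ᵥ (B *ᵥ Sum.elim y z) = star y ⬝ᵥ (A *ᵥ y) + star z ⬝ᵥ z := by
      intro y z
      rw [hB, fromBlocks_mulVec, Sum.elim_comp_inl, Sum.elim_comp_inr, Matrix.zero_mulVec,
        Matrix.zero_mulVec, Matrix.one_mulVec, add_zero, zero_add, Function.star_sumElim,
        sumElim_dotProduct_sumElim]
    rw [hxe, key]
    rcases hx' with hl | hr
    · exact add_pos_of_pos_of_nonneg (hX.dotProduct_mulVec_pos hl) (dotProduct_star_self_nonneg _)
    · exact add_pos_of_nonneg_of_pos (hX.posSemidef.dotProduct_mulVec_nonneg _)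
        (dotProduct_star_self_pos_iff.mpr hr)
  set e := Equiv.sumCompl (fun i : ι => i ∈ C) with he
  refine ⟨B.submatrix e.symm e.symm, hBpd.submatrix e.symm.injective, fun i hi j hj => ?_⟩
  rw [submatrix_apply, he, Equiv.sumCompl_symm_apply_of_pos hi,
    Equiv.sumCompl_symm_apply_of_pos hj, hB, fromBlocks_apply₁₁, hA, submatrix_apply]

/-- **MAXIMUM-DETERMINANT POSITIVE DEFINITE COMPLETION WITH A CHORDAL PATTERN** ([VA15, §10.2]:
"(10.3) is solvable for all `A ∈ Π_E(𝐒ⁿ₊₊)`" with optimality conditions (10.5)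
`Π_E(W) = A, W ≻ 0, W⁻¹ ∈ 𝐒ⁿ_E`; [FKMN01, Lemma 2.7 with Thm 2.4]; [GJSW84, Thm 2 in the chordal
case of Thm 7]): for a symmetric monotone-transitive (perfect-elimination-ordered) pattern `E`, if
every clique block `col(v) × col(v)` of the partial matrix `X` extends to a positive definite
matrix, then there is a positive definite `W` agreeing with `X` on all prescribed entries whose
INVERSE HAS SPARSITY PATTERN `E`; by `det_le_det_of_inv_hasPattern` it is the unique maximiser of
`det` among all positive semidefinite completions.
[cite: VandenbergheAndersen2015, §10.2 eq. (10.3)–(10.5) and Algorithm 10.1] -/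
theorem exists_posDef_completion_inv_hasPattern {E : ι → ι → Prop}
    (hEs : ∀ ⦃i j : ι⦄, E i j → E j i) (hEm : MonotoneTransitive E) {X : Matrix ι ι 𝕜}
    (hloc : ∀ v, ∃ G : Matrix ι ι 𝕜, G.PosDef ∧
      ∀ i ∈ clique E v, ∀ j ∈ clique E v, G i j = X i j) :
    ∃ W : Matrix ι ι 𝕜, W.PosDef ∧ (∀ i j, (i = j ∨ E i j) → W i j = X i j) ∧
      HasPattern E W⁻¹ ∧
      ∀ W' : Matrix ι ι 𝕜, W'.PosSemidef → (∀ i j, (i = j ∨ E i j) → W' i j = X i j) →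
        W'.det ≤ W.det ∧ (W'.det = W.det → W' = W) := by
  obtain ⟨W, K, hW, -, hWX, -, hKE, hKW⟩ := exists_completion_and_inverse_of_subset hEs hEm X
    Finset.univ fun v _ => by
      obtain ⟨G, hG, hGX⟩ := hloc v
      exact ⟨G, hG, fun i _ hi j _ hj => hGX i hi j hj⟩
  have hKW1 : K * W = 1 := by
    rw [hKW]
    ext i j
    simp [diagonal_apply, Matrix.one_apply]
  have hunit : IsUnit W := by
    rw [isUnit_iff_isUnit_det]
    exact isUnit_det_of_left_inverse hKW1
  have hWpd : W.PosDef := hW.posDef_iff_isUnit.mpr hunit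
  have hinv : W⁻¹ = K := inv_eq_left_inv hKW1
  have hWX' : ∀ i j, (i = j ∨ E i j) → W i j = X i j := fun i j hij =>
    hWX i (Finset.mem_univ i) j (Finset.mem_univ j) hij
  refine ⟨W, hWpd, hWX', hinv ▸ hKE, fun W' hW' hW'X => ?_⟩
  exact det_le_det_of_inv_hasPattern hEs hWpd (hinv ▸ hKE) hW' fun i j hij => by
    rw [hW'X i j hij, hWX' i j hij]

/-- **[FKMN01, Thm 2.5(ii)] / the interior half of [VA15, Thm 10.1]** (`A ∈ Π_E(𝐒ⁿ₊₊) ⟺ all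
clique blocks `A_ββ ≻ 0`; [GJSW84, Thm 7] "if" in the positive definite setting): for a symmetric
monotone-transitive (chordal, perfect-elimination-ordered) pattern `E`, a partial matrix `X` has a
positive DEFINITE completion iff every clique block `X[col(v), col(v)]` is positive definite.
[cite: FukudaEtAl2001, Thm 2.5(ii)] -/
theorem posDef_completable_iff {E : ι → ι → Prop} (hEs : ∀ ⦃i j : ι⦄, E i j → E j i)
    (hEm : MonotoneTransitive E) (X : Matrix ι ι 𝕜) :
    (∃ W : Matrix ι ι 𝕜, W.PosDef ∧ ∀ i j, (i = j ∨ E i j) → W i j = X i j) ↔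
      ∀ v, (X.submatrix (Subtype.val : clique E v → ι) Subtype.val).PosDef := by
  constructor
  · rintro ⟨W, hW, hWX⟩ v
    have hXW : X.submatrix (Subtype.val : clique E v → ι) (Subtype.val : clique E v → ι) =
        W.submatrix (Subtype.val : clique E v → ι) (Subtype.val : clique E v → ι) := by
      ext ⟨i, hi⟩ ⟨j, hj⟩
      simp only [submatrix_apply]
      refine (hWX i j ?_).symm
      by_cases hij : i = j
      · exact Or.inl hij
      · exact Or.inr (clique_complete hEs hEm v hi hj hij)
    rw [hXW]
    exact hW.submatrix Subtype.val_injective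
  · intro hX
    classical
    obtain ⟨W, hW, hWX, -⟩ := exists_posDef_completion_inv_hasPattern hEs hEm fun v =>
      exists_posDef_of_submatrix_posDef (clique E v) (hX v)
    exact ⟨W, hW, hWX⟩

/-- **THE MAXIMUM-DETERMINANT COMPLETION THEOREM FOR CHORDAL PATTERNS** ([FKMN01, Thm 2.4 with
Lemma 2.7]; [VA15, §10.2]; [GJSW84, Thm 2]), clique condition on principal submatrices: if `E` is
a symmetric monotone-transitive pattern and every clique block `X[col(v), col(v)]` is positive
definite, then among all positive semidefinite completions of `X` there is a unique one of
maximal determinant, `Ŵ`; it is positive definite and it is THE completion whose inverse has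
sparsity pattern `E` (`[Ŵ⁻¹]_{ij} = 0` for `i ≠ j`, `{i,j} ∉ E`).
[cite: FukudaEtAl2001, Thm 2.4 and Lemma 2.7] -/
theorem exists_unique_maxDet_completion {E : ι → ι → Prop} (hEs : ∀ ⦃i j : ι⦄, E i j → E j i)
    (hEm : MonotoneTransitive E) {X : Matrix ι ι 𝕜}
    (hX : ∀ v, (X.submatrix (Subtype.val : clique E v → ι) Subtype.val).PosDef) :
    ∃ W : Matrix ι ι 𝕜, W.PosDef ∧ (∀ i j, (i = j ∨ E i j) → W i j = X i j) ∧
      HasPattern E W⁻¹ ∧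
      (∀ W' : Matrix ι ι 𝕜, W'.PosSemidef → (∀ i j, (i = j ∨ E i j) → W' i j = X i j) →
        W'.det ≤ W.det ∧ (W'.det = W.det → W' = W)) ∧
      ∀ W' : Matrix ι ι 𝕜, W'.PosDef → (∀ i j, (i = j ∨ E i j) → W' i j = X i j) →
        HasPattern E W'⁻¹ → W' = W := by
  classical
  obtain ⟨W, hW, hWX, hWinv, hmax⟩ := exists_posDef_completion_inv_hasPattern hEs hEm fun v =>
    exists_posDef_of_submatrix_posDef (clique E v) (hX v)
  exact ⟨W, hW, hWX, hWinv, hmax, fun W' hW' hW'X hW'inv =>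
    eq_of_posDef_of_inv_hasPattern hEs hW' hW'inv hW hWinv fun i j hij => by
      rw [hW'X i j hij, hWX i j hij]⟩

/-- The maximum-determinant completion theorem for a `SimpleGraph` whose vertex order is a
perfect elimination ordering (`MonotoneTransitive G.Adj`): positive definite completability is
the clique-PD condition. [cite: FukudaEtAl2001, Thm 2.5(ii)] -/
theorem simpleGraph_posDef_completable_iff (G : SimpleGraph ι) (hG : MonotoneTransitive G.Adj)
    (X : Matrix ι ι 𝕜) :
    (∃ W : Matrix ι ι 𝕜, W.PosDef ∧ ∀ i j, (i = j ∨ G.Adj i j) → W i j = X i j) ↔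
      ∀ v, (X.submatrix (Subtype.val : clique G.Adj v → ι) Subtype.val).PosDef :=
  posDef_completable_iff (fun _ _ h => G.adj_symm h) hG X

end Existence

/-! ### The dual problem (10.4): covariance selection -/

section Dual

variable [Fintype ι] [DecidableEq ι]

/-- **THE DUAL OF MAXIMUM-DETERMINANT COMPLETION / DEMPSTER'S COVARIANCE SELECTION**
([VA15, §10.2, (10.4)–(10.5)]: `minimize tr(AY) - log det Y` over `Y ∈ 𝐒ⁿ₊₊ ∩ 𝐒ⁿ_E`, whose
solution is `Y = Ŵ⁻¹` for the maximum-determinant completion `Ŵ`; [VBW98, §2.2 (2.2)–(2.3) and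
§3]), for an ARBITRARY symmetric pattern `E`: if `W ≻ 0` agrees with `A` on the prescribed
entries and `W⁻¹` has pattern `E`, then for every `Y ≻ 0` with pattern `E`
`Re tr(A W⁻¹) - log det W⁻¹ ≤ Re tr(A Y) - log det Y`, with equality only for `Y = W⁻¹`, and the
optimal value is `n + log det W` (zero duality gap with (10.3)).  (`tr(AY) = tr(WY)` since `Y` only
sees prescribed entries; then `log_det_sub_log_det_le` at the point `W⁻¹`.)
[cite: VandenbergheAndersen2015, §10.2 eq. (10.4)–(10.5)] -/
theorem covarianceSelection_optimal {E : ι → ι → Prop} (hEs : ∀ ⦃i j : ι⦄, E i j → E j i)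
    {A W Y : Matrix ι ι 𝕜} (hW : W.PosDef) (hWA : ∀ i j, (i = j ∨ E i j) → W i j = A i j)
    (hWinv : HasPattern E W⁻¹) (hY : Y.PosDef) (hYE : HasPattern E Y) :
    (RCLike.re ((A * W⁻¹).trace) - Real.log (RCLike.re W⁻¹.det) ≤
        RCLike.re ((A * Y).trace) - Real.log (RCLike.re Y.det) ∧
      (RCLike.re ((A * W⁻¹).trace) - Real.log (RCLike.re W⁻¹.det) =
          RCLike.re ((A * Y).trace) - Real.log (RCLike.re Y.det) → Y = W⁻¹)) ∧
      RCLike.re ((A * W⁻¹).trace) - Real.log (RCLike.re W⁻¹.det) =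
        Fintype.card ι + Real.log (RCLike.re W.det) := by
  have hu : IsUnit W.det := (isUnit_iff_isUnit_det W).mp hW.isUnit
  -- `tr(A Y) = tr(W Y)` and `tr(A W⁻¹) = n`: the pattern of `Y`, `W⁻¹` only sees prescribed entries
  have hAW : ∀ i j, (i = j ∨ E i j) → A i j = W i j := fun i j h => (hWA i j h).symm
  have htrY : (A * Y).trace = (W * Y).trace := by
    rw [Matrix.trace_mul_comm A Y, trace_mul_eq_of_hasPattern_of_agree hEs hYE hAW,
      Matrix.trace_mul_comm Y W]
  have htrW : (A * W⁻¹).trace = (Fintype.card ι : 𝕜) := by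
    rw [Matrix.trace_mul_comm A W⁻¹, trace_mul_eq_of_hasPattern_of_agree hEs hWinv hAW,
      nonsing_inv_mul W hu, trace_one]
  -- `det W⁻¹ = (det W)⁻¹`, a positive real
  obtain ⟨hWre, hWpos⟩ := eq_ofReal_re_of_pos hW.det_pos
  have hdetinv : RCLike.re W⁻¹.det = (RCLike.re W.det)⁻¹ := by
    rw [det_nonsing_inv, Ring.inverse_eq_inv]
    conv_lhs => rw [hWre, ← RCLike.ofReal_inv, RCLike.ofReal_re]
  have hval : RCLike.re ((A * W⁻¹).trace) - Real.log (RCLike.re W⁻¹.det) =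
      Fintype.card ι + Real.log (RCLike.re W.det) := by
    rw [htrW, RCLike.natCast_re, hdetinv, Real.log_inv]
    ring
  -- the gradient inequality at `W⁻¹`
  obtain ⟨hle, heq⟩ := log_det_sub_log_det_le hW.inv hY
  rw [nonsing_inv_nonsing_inv W hu, hdetinv, Real.log_inv] at hle heq
  refine ⟨⟨?_, fun h => heq ?_⟩, hval⟩
  · rw [hval, htrY]
    linarith
  · rw [hval, htrY] at h
    linarith

end Dual

/-! ### Packaging: the covariance selection theorem for chordal patterns -/

section CovarianceSelection

variable [Fintype ι] [LinearOrder ι]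

/-- **COVARIANCE SELECTION WITH A CHORDAL PATTERN** ([VA15, §10.2]: for `A ∈ Π_E(𝐒ⁿ₊₊)` the dual
(10.4) has the unique solution `Y = Ŵ⁻¹ ∈ 𝐒ⁿ₊₊ ∩ 𝐒ⁿ_E`, computed by Algorithm 10.1; Dempster
1972): for a symmetric monotone-transitive pattern `E` and a partial matrix `X` all of whose clique
blocks `X[col(v), col(v)]` are positive definite, there is a positive definite `Y` WITH PATTERN `E`
whose inverse is a completion of `X`; it is the unique minimiser of `Re tr(X Y') - log det Y'` over
positive definite `Y'` with pattern `E`.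
[cite: VandenbergheAndersen2015, §10.2 eq. (10.4)–(10.5) and Algorithm 10.1] -/
theorem exists_covarianceSelection {E : ι → ι → Prop} (hEs : ∀ ⦃i j : ι⦄, E i j → E j i)
    (hEm : MonotoneTransitive E) {X : Matrix ι ι 𝕜}
    (hX : ∀ v, (X.submatrix (Subtype.val : clique E v → ι) Subtype.val).PosDef) :
    ∃ Y : Matrix ι ι 𝕜, Y.PosDef ∧ HasPattern E Y ∧ (∀ i j, (i = j ∨ E i j) → Y⁻¹ i j = X i j) ∧
      ∀ Y' : Matrix ι ι 𝕜, Y'.PosDef → HasPattern E Y' →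
        RCLike.re ((X * Y).trace) - Real.log (RCLike.re Y.det) ≤
            RCLike.re ((X * Y').trace) - Real.log (RCLike.re Y'.det) ∧
          (RCLike.re ((X * Y).trace) - Real.log (RCLike.re Y.det) =
              RCLike.re ((X * Y').trace) - Real.log (RCLike.re Y'.det) → Y' = Y) := by
  classical
  obtain ⟨W, hW, hWX, hWinv, -⟩ := exists_unique_maxDet_completion hEs hEm hX
  have hu : IsUnit W.det := (isUnit_iff_isUnit_det W).mp hW.isUnit
  refine ⟨W⁻¹, hW.inv, hWinv, fun i j hij => ?_, fun Y' hY' hY'E => ?_⟩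
  · rw [nonsing_inv_nonsing_inv W hu, hWX i j hij]
  · exact (covarianceSelection_optimal hEs hW hWX hWinv hY' hY'E).1

end CovarianceSelection

end ChordalSparsity

end Literature.LinearAlgebra.Matrix

end
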